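import Literature.Geometry.Kaehler.ComplexTorusAbelianSurfaceShimura
import Literature.Geometry.Kaehler.ComplexTorusHodgeLieAlgebraAbelianSurfacesSixTypes
import Literature.Geometry.Kaehler.ComplexTorusHodgeLieAlgebraCommutativeDimension
import Literature.Geometry.Kaehler.ComplexTorusHodgeGroupHodgeCircleMaximalPicard
import Literature.Geometry.Kaehler.ComplexTorusHodgeGroupLieAlgebraAlgebraic
import Literature.Geometry.Kaehler.ComplexTorusHodgeLieAlgebraSymplecticDimension
import HarnessLib

/-!
# Moonen–Zarhin 1999 (2.2), Type IV(2,1), and Prop. (2.4) (2) at `g = 2`: a SIMPLE abelian SURFACE with COMPLEX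
# MULTIPLICATION (`End⁰(X)` a quartic CM field) has `dim Hg(X) = dim_ℝ 𝔥𝔤_ℝ = 2`, `(dim 𝔨, dim 𝔭) = (2, 0)`,
# and `Hg(X)(ℝ)` is commutative (`Hg(X) = U_F`, a `2`-dimensional torus)

Layer `Literature/Geometry/Kaehler`, namespace `Literature.Geometry.Kaehler.ComplexTorus`; lane `lit-hodgefound`
(Track 2 foundations library), Layer A4; prover seat `lit-hodgefound-p17` (generation 48), self-proposed row g48-#7 —
the DIMENSION half of the last entry of Moonen–Zarhin's list (2.2) for `g = 2` («Type IV(2,1): `End⁰(X) = F` is a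
quartic CM-field […] We have `Hg(X) = U_F`»; `dim U_F = [F : ℚ]/2 = 2`), at the torus level and for an ARBITRARY simple
surface with commutative four-dimensional `End⁰(X)` (no CM-type model is chosen).  Upper bound: `End⁰(X)` is a
commutative reduced (indeed a field) subalgebra of `M_κ(ℚ)` of dimension `4 = 2g`, so `X` is of CM type and
`dim_ℝ 𝔥𝔤_ℝ ≤ g = 2` (`IsRiemannForm.finrank_hodgeGroupLie_le_of_exists_comm_isReduced_le_endAlgRat`, Lange Prop. 7.2.6).
Lower bound: `dim_ℝ 𝔥𝔤_ℝ = 1` would make `Hg(X)(ℝ) = h(S¹)` and `ρ(X) = g² = 4` (Beauville's criterion,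
`coe_hodgeGroup_eq_range_iff_finrank_neronSeveriGroup_eq_sq`), while a simple abelian surface has `ρ(X) ≤ 3`
(`IsSimple.finrank_neronSeveriGroup_of_finrank_eq_two`).  Shimura's exclusion (`End⁰(X)` of a simple surface is never
an imaginary quadratic field, `IsSimple.finrank_centerField_eq_four_of_isCMField_of_finrank_eq_two`) feeds the CM-field
and Albert-type-IV forms.

THEOREMS ONLY (no definition, no instance, no notation, no named fact; D-0026, net debt 0); nothing restated.  NOT here
(recorded): `Hg(X) = Lf(X) = U_F` itself and `ℬ•(Xⁿ) = 𝒟•(Xⁿ)` for these surfaces, which need `dim Lf(X) = 2`.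

## Sources, VERBATIM (held copies; `p0NNN Lnn` = chunk file and line of the materialised text)

* B. Moonen, Yu. G. Zarhin, *Hodge classes on abelian varieties of low dimension*, Math. Ann. 315 (1999), held
  `paper:arxiv-math_9901113` (no statement numbers in the held TeX; «(2.2)» = the `g = 2` list of §2, «Prop. (2.4)» = the
  Proposition of §2 on simple `X` with `g ≤ 3`): (2.2) `g = 2` (p0005 L77–L78) «Type IV(2,1): `End⁰(X) = F` is a quartic
  CM-field not containing an imaginary quadratic subfield. We have `Hg(X) = U_F`», with (p0005 L26–L31) «If `F` is a
  CM-field […] we shall write `U_F` for the algebraic torus over `ℚ` given on points by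
  `U_F(R) = {x ∈ (F ⊗_ℚ R)* ∣ x x̄ = 1}`»; Prop. (2.4) (p0005 L110–L117) «Let `X` be a simple complex abelian variety with
  `g = dim(X) ≤ 3`. […] (2) Suppose `X` is of CM-type. Then `Hg(X)` is a `g`-dimensional algebraic torus».
* H. Lange, *Abelian Varieties over the Complex Numbers* (2023), §7.2.3 Prop. 7.2.6 (CM type ⟺ `Hg(X)` a torus, and
  then `dim Hg(X) ≤ g`), §5.1.5 Exercise (2)(b)(iii) (the CM endomorphism algebras of simple surfaces).
* A. Beauville, *Some surfaces with maximal Picard number* (2014), §3 Prop. 3 (`ρ = g²` ⟺ `Hg = h(S¹)`), via the tree.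
* K. Hulek, R. Laface (2019), held `paper:arxiv-1703.05882`, §5.1 Prop. 5.1 (Shimura's exclusions for simple surfaces).
* F. Fité, K. S. Kedlaya, V. Rotger, A. V. Sutherland (2012), held `paper:arxiv-1110.6638`, §4.2 (p0014 L57–L62, L82)
  «(**D**) `ℂ × ℂ`, which occurs when […] `A_K` is simple and `End(A_K)` is an order in a quartic CM-field», «**D**:
  `U(1) × U(1)`» (the compact `2`-torus: `dim_ℝ 𝔥𝔤_ℝ = 2`, `𝔭 = 0`).

## Contents (all for a SIMPLE abelian surface `X = E/Ψ(ℤ^κ)`)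

* §1 **`IsSimple.finrank_hodgeGroupLie_eq_two_of_endAlgRat_comm_of_finrank_eq_two`** — `End⁰(X)` commutative of
  dimension `4` ⟹ `dim_ℝ 𝔥𝔤_ℝ = 2`; the forms `…_of_isCMField_…` (`[IsCMField (centerField Ψ hX)]`) and
  `…_of_isAlbertTypeIV_…`; `dim_ℂ 𝔤 = 2`, `dim Hg(X) = 2` (`zdim`), `(dim 𝔨, dim 𝔭) = (2, 0)`, `Hg(X)(ℝ)` commutative.
-/

noncomputable section

open scoped Matrix
open Module Matrix NormedSpace NumberField
open Literature.RingTheory.CentralSimple (IsAlbertTypeIV)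
open Literature.NumberTheory.Automorphic (IsZConnected)

namespace Literature.Geometry.Kaehler

namespace ComplexTorus

section ComplexMultiplicationSurface

variable {κ : Type} [Fintype κ] [DecidableEq κ] [Nonempty κ] {E : Type} [NormedAddCommGroup E] [NormedSpace ℂ E]
  [FiniteDimensional ℂ E] {Ψ : (κ → ℝ) ≃L[ℝ] E} {η : E [⋀^Fin 2]→L[ℝ] ℝ} {G : Matrix κ κ ℚ}

omit [FiniteDimensional ℂ E] in
/-- `ℚ ⊆ K ⊆ End_ℚ(X)` is a scalar tower. [folklore] -/
private theorem isScalarTower_rat₄₈ (hX : IsSimple Ψ) : IsScalarTower ℚ (centerField Ψ hX) (endAlgRat Ψ) :=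
  IsScalarTower.of_algebraMap_smul fun q x ↦ by
    rw [Algebra.smul_def, Algebra.algebraMap_eq_smul_one q,
      map_rat_smul (algebraMap (centerField Ψ hX) (endAlgRat Ψ)) q 1, map_one, smul_mul_assoc, one_mul]

/-- **`dim_ℝ 𝔥𝔤_ℝ = 2` FOR A SIMPLE ABELIAN SURFACE WITH COMMUTATIVE FOUR-DIMENSIONAL `End⁰(X)`** (then `End⁰(X) = F`
is a quartic CM field and «`Hg(X) = U_F`», a `2`-dimensional torus; «Suppose `X` is of CM-type. Then `Hg(X)` is a
`g`-dimensional algebraic torus», `g = 2`).  `≤ 2`: `End⁰(X)` is a commutative reduced subalgebra of dimension `2g`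
(CM type, Lange Prop. 7.2.6); `≠ 1`: `dim 𝔥𝔤_ℝ = 1` forces `Hg(X)(ℝ) = h(S¹)` and `ρ(X) = g² = 4`, impossible for a
simple surface (`ρ ≤ 3`). [cite: MoonenZarhin1999LowDim, §2 (2.2) `g = 2` («Type IV(2,1) … `Hg(X) = U_F`») and §2 Prop. (2.4) (2) («a `g`-dimensional algebraic torus»)]
[cite: Lange2023AbelianVarietiesComplex, §7.2.3 Prop. 7.2.6] [cite: Beauville2014MaximalPicard, §3 Prop. 3] -/
theorem IsSimple.finrank_hodgeGroupLie_eq_two_of_endAlgRat_comm_of_finrank_eq_two (hX : IsSimple Ψ)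
    (hη : IsRiemannForm Ψ η) (h2 : finrank ℂ E = 2) (hcomm : ∀ a ∈ endAlgRat Ψ, ∀ b ∈ endAlgRat Ψ, a * b = b * a)
    (h4 : finrank ℚ (endAlgRat Ψ) = 4) : finrank ℝ (hodgeGroupLie Ψ) = 2 := by
  -- `≤ 2`: CM type
  haveI : IsReduced (endAlgRat Ψ) := by letI := hX.divisionRing; infer_instance
  have hle : finrank ℝ (hodgeGroupLie Ψ) ≤ finrank ℂ E :=
    hη.finrank_hodgeGroupLie_le_of_exists_comm_isReduced_le_endAlgRat
      ⟨endAlgRat Ψ, le_rfl, inferInstance, hcomm, by rw [h4, card_eq_two_mul_finrank Ψ, h2]⟩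
  -- `≠ 1`: otherwise `Hg(X)(ℝ) = h(S¹)` and `ρ(X) = 4`
  have hne : finrank ℝ (hodgeGroupLie Ψ) ≠ 1 := fun h1 ↦ by
    have hS := (coe_hodgeGroup_eq_range_iff_finrank_hodgeGroupLie_eq_one Ψ (by omega)).2 h1
    have hρ := (coe_hodgeGroup_eq_range_iff_finrank_neronSeveriGroup_eq_sq Ψ (by omega)).1 hS
    rw [h2] at hρ
    rcases hX.finrank_neronSeveriGroup_of_finrank_eq_two hη h2 with h | h | h <;> omega
  -- `∈ {1, 2, 3, 4, 6, 10}`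
  have hmem := hη.finrank_hodgeGroupLie_mem_six_of_finrank_eq_two h2
  simp only [Finset.mem_insert, Finset.mem_singleton] at hmem
  omega

/-- **`dim_ℝ 𝔥𝔤_ℝ = 2` for a simple abelian surface whose endomorphism algebra has CM centre** (then `End⁰(X) = K` is a
quartic CM field by Shimura's exclusion of imaginary quadratic `End⁰`): Type IV(2,1), «`Hg(X) = U_F`».
[cite: MoonenZarhin1999LowDim, §2 (2.2) `g = 2` («Type IV(2,1)») and Prop. (2.4) (2)] [cite: HulekLaface2019PicardNumbersAV, §5.1 Prop. 5.1]
[cite: FiteEtAl2012, §4.2 (type **D**: «`A_K` is simple and `End(A_K)` is an order in a quartic CM-field» ↔ `U(1) × U(1)`)] -/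
theorem IsSimple.finrank_hodgeGroupLie_eq_two_of_isCMField_of_finrank_eq_two (hX : IsSimple Ψ)
    (hη : IsRiemannForm Ψ η) (h2 : finrank ℂ E = 2) [IsCMField (centerField Ψ hX)] :
    finrank ℝ (hodgeGroupLie Ψ) = 2 := by
  haveI := isScalarTower_rat₄₈ hX
  obtain ⟨hK4, hF1⟩ := hX.finrank_centerField_eq_four_of_isCMField_of_finrank_eq_two hη h2
  have h4 : finrank ℚ (endAlgRat Ψ) = 4 := by
    rw [← Module.finrank_mul_finrank ℚ (centerField Ψ hX) (endAlgRat Ψ), hK4, hF1]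
  exact hX.finrank_hodgeGroupLie_eq_two_of_endAlgRat_comm_of_finrank_eq_two hη h2
    (fun a ha b hb ↦ congrArg Subtype.val (hX.mul_comm_of_finrank_eq_one hF1 ⟨a, ha⟩ ⟨b, hb⟩)) h4

/-- **`dim_ℝ 𝔥𝔤_ℝ = 2` for a simple abelian surface of Albert type IV** (for the Rosati involution of some polarisation).
[cite: MoonenZarhin1999LowDim, §2 (2.2) `g = 2` («Type IV(2,1) … `Hg(X) = U_F`») and Prop. (2.4) (2)]
[cite: Lange2023AbelianVarietiesComplex, §5.1.5 Exercise (2)(b) and §7.2.3 Prop. 7.2.6] -/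
theorem IsSimple.finrank_hodgeGroupLie_eq_two_of_isAlbertTypeIV_of_finrank_eq_two (hX : IsSimple Ψ)
    (hη : IsRiemannForm Ψ η) (hG : G.map (Rat.cast : ℚ → ℝ) = latticeGram Ψ η)
    (h : IsAlbertTypeIV (centerField Ψ hX) (endAlgRat Ψ) (rosatiEnd Ψ hη.1 hη.2.2 hG)) (h2 : finrank ℂ E = 2) :
    finrank ℝ (hodgeGroupLie Ψ) = 2 := by
  haveI := h.isCMField
  exact hX.finrank_hodgeGroupLie_eq_two_of_isCMField_of_finrank_eq_two hη h2

/-- **`dim_ℂ 𝔤 = 2`** (`𝔤 = Lie Hg(X)(ℂ)`) for a simple abelian surface with CM centre.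
[cite: MoonenZarhin1999LowDim, §2 (2.2) `g = 2` («Type IV(2,1)») and Prop. (2.4) (2)] -/
theorem IsSimple.finrank_hodgeGroupComplexLie_eq_two_of_isCMField_of_finrank_eq_two (hX : IsSimple Ψ)
    (hη : IsRiemannForm Ψ η) (h2 : finrank ℂ E = 2) [IsCMField (centerField Ψ hX)] :
    finrank ℂ (hodgeGroupComplexLie Ψ) = 2 := by
  rw [finrank_hodgeGroupComplexLie_eq_finrank_hodgeGroupLie Ψ]
  exact hX.finrank_hodgeGroupLie_eq_two_of_isCMField_of_finrank_eq_two hη h2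

/-- **`dim Hg(X) = 2 = g`** (the trunk's `zdim` of the connected algebraic group `Hg(X)(ℂ) ≤ GL(V_ℂ)`) for a simple
abelian surface with CM centre: «Then `Hg(X)` is a `g`-dimensional algebraic torus». [cite: MoonenZarhin1999LowDim, §2 Prop. (2.4) (2) and (2.2) («`Hg(X) = U_F`»)]
[cite: GoodmanWallachGTM255, §1.4.4 Thm. 1.4.10] -/
theorem IsSimple.zdim_hodgeGroupC_eq_two_of_isCMField_of_finrank_eq_two (hX : IsSimple Ψ) (hη : IsRiemannForm Ψ η)
    (h2 : finrank ℂ E = 2) [IsCMField (centerField Ψ hX)] : (isZConnected_map_toGL_hodgeGroupC Ψ).zdim = 2 :=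
  (zdim_hodgeGroupC_eq_iff_finrank_hodgeGroupLie_eq Ψ).2 (hX.finrank_hodgeGroupLie_eq_two_of_isCMField_of_finrank_eq_two hη h2)

/-- **`(dim 𝔨, dim 𝔭) = (2, 0)`** for a simple abelian surface with CM centre (`𝔥𝔤_ℝ = 𝔨 ≅ 𝔲(1)²`; Sato–Tate type
**D**, `U(1) × U(1)`). [cite: FiteEtAl2012, §4.2 (type **D** ↔ `U(1) × U(1)`) and §3.2 Lemma 3.7]
[cite: MoonenZarhin1999LowDim, §2 Prop. (2.4) (2)] [cite: Lange2023AbelianVarietiesComplex, §7.2.3 Prop. 7.2.6] -/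
theorem IsSimple.finrank_hodgeIsotropyLie_eq_two_of_isCMField_of_finrank_eq_two (hX : IsSimple Ψ)
    (hη : IsRiemannForm Ψ η) (h2 : finrank ℂ E = 2) [IsCMField (centerField Ψ hX)] :
    finrank ℝ (hodgeIsotropyLie Ψ) = 2 ∧ finrank ℝ (hodgeCartanP Ψ) = 0 := by
  have hd := hX.finrank_hodgeGroupLie_eq_two_of_isCMField_of_finrank_eq_two hη h2
  have hbot := (hη.finrank_hodgeGroupLie_le_two_iff_of_finrank_eq_two h2).1 hd.le
  have hsum := finrank_hodgeGroupLie_eq_finrank_hodgeIsotropyLie_add_finrank_hodgeCartanP Ψ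
  have hp : finrank ℝ (hodgeCartanP Ψ) = 0 := by rw [hbot, finrank_bot]
  exact ⟨by omega, hp⟩

/-- **`Hg(X)(ℝ)` IS COMMUTATIVE for a simple abelian surface with CM centre** (a compact `2`-torus `U_F(ℝ)`).
[cite: MoonenZarhin1999LowDim, §2 (2.2) `g = 2` («`Hg(X) = U_F`») and Prop. (2.4) (2)] [cite: Lange2023AbelianVarietiesComplex, §7.2.3 Prop. 7.2.6] -/
theorem IsSimple.hodgeGroup_comm_of_isCMField_of_finrank_eq_two (hX : IsSimple Ψ) (hη : IsRiemannForm Ψ η)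
    (h2 : finrank ℂ E = 2) [IsCMField (centerField Ψ hX)] :
    ∀ M ∈ hodgeGroup Ψ, ∀ N ∈ hodgeGroup Ψ, M * N = N * M :=
  IsAbelianVariety.hodgeGroup_comm_of_finrank_hodgeGroupLie_le_two ⟨η, hη⟩
    (hX.finrank_hodgeGroupLie_eq_two_of_isCMField_of_finrank_eq_two hη h2).le

end ComplexMultiplicationSurface

end ComplexTorus

end Literature.Geometry.Kaehler
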